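import Literature.MathematicalPhysics.QuantumFieldTheory.Balaban1983to89.B8SectEKLevelInLambda
import Literature.MathematicalPhysics.QuantumFieldTheory.Balaban1983to89.B9B8KnitLetterPeriodic
import Literature.MathematicalPhysics.QuantumFieldTheory.Balaban1983to89.B8Prop5NeumannPeriodic

/-!
# `Balaban1983to89.B8SectEKLevelPer` — [Balaban1985RegularSpaces] Sect. E (1.113)–(1.118) pp. 95–97 ON THE TORUS (§3 p. 98): the solution
# `D′(λ)` of (1.117) IS PERIODIC for periodic data, and (1.114) follows from `Q′H′ = I` READ AT PERIODIC families only
# (sub-row «G-B8-T2S», RULING #4 v3, layer 3(e) of `lit-balaban-t2s-1/g2/V3-DESIGN.md`)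

statement-level skeleton of published theorems with citation tags; proofs where landed; nothing here is a claim about the
Yang–Mills mass gap

T. Bałaban, *Spaces of regular gauge field configurations on a lattice and gauge fixing conditions*, Commun. Math. Phys. **99** (1985) 75–102
`[Balaban1985RegularSpaces]` ("B8"): (1.113)–(1.118) pp. 95–96, p. 97, (1.91) p. 91, (1.78)–(1.79) p. 90, §3 p. 98.  T. Bałaban, *Averaging
operations for lattice gauge theories*, CMP **98** (1985) 17–51 `[Balaban1985Averaging]` ("[3]"): (178)–(179) p. 45, (208), (213) p. 50.
STATUS: published, refereed.

CITATION HEADER (lean-in-tree rule).  Cell `lit-balaban`, seat `lit-balaban-t2s-1` (gen 2).  WHAT IS PROVED (0 sorry, no `def`).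
* §1 translation covariance of the nonlinear averages: `util178_shiftCfg` (ũ′ʲ of (1.78)), `Qnl_shiftCfg` ((208) `Q′_j(u₁, λ)`), `Cnl_shiftCfg`
  ((213)'s remainder `C′_j`), after `B8TorusShiftAveraging.Rbar_bgT_shiftCfg` and `B9B8KnitLetterPeriodic.QprimeIter_bgT_shiftCfg`; hence
  `Cnl_per`: `C′_j(u₁, λ)` is `P/Lʲ`-periodic on the `j`-lattice for `P`-periodic `U₀`, `u₁`, `λ` (`Lʲ ∣ P`).
* §2 `isClosed_perX_and_zero_mem` (the level-periodic `X : 𝔅_k → 𝔤` form a closed set containing `0`), `perX_of_image` (the masked (1.118) maps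
  it to itself), `eq1114_of_fixedPoint_kLevel_at` (`B8Eq1117KLevel.eq1114_of_fixedPoint_kLevel` with `Q′H′ = I` read AT THE SOLUTION only).
* §3 ★ `exists_Dprime_kLevel_w_per`, ★ `exists_Dprime_kLevel_inv_of_axial_per` — `B8SectEKLevelInLambda.exists_Dprime_kLevel_w ∕ _inv_of_axial`
  VERBATIM except: `hQH` ((1.91) `Q′H′ = I` on `𝔅_k`) is assumed for level-PERIODIC families `Y` only (RULING #4: the torus letter `H′` of
  `B8Thm2TorusLettersPer`), plus the torus data (`Lʲ ∣ P`, shift-invariant `Λ_j`, periodic `U₀`, `u₁`, `λ`, `H′` periodic-valued on periodic `X`);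
  ADDED conclusion: `D′(λ)` is level-periodic (by `B8SectEKLevelInLambda.eq1117_solution_mem_of_invariant_w`, r05's closed-invariant-set device).

HONEST SCOPE.  Verbatim re-threads + bookkeeping identities; the contraction (1.117) itself is n04-b/n05-b's (by name); count-neutral; N05 ∕
`stub_PV3A` NOT discharged; nothing continuum ∕ ℝ⁴ ∕ OS ∕ mass-gap ∕ Clay — the Yang–Mills mass gap is NOT proved.  No `sorry`, no `def`, no
`… : Prop` fact, no `instance`, no `notation`.
-/

noncomputable section

open NormedSpace Finset

namespace Literature.MathematicalPhysics.QuantumFieldTheory.Balaban1983to89.B8SectEKLevelPer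

open B7Prop1Explicit B7Prop2Explicit B7Prop3Flat B7Prop1Local B7Eq167Flat B7Eq167General
open B7Eq170Flat (cj cj_apply)
open B7Prop10General (C6 C4G)
open B7Prop10Flat (one_le_C5 C4'_nonneg C5'_nonneg)
open B7Prop9Flat (C5')
open B8Ineq130 (tlo thi)
open B7Eq92Concrete (mgauge)
open B7Eq78Linearization (zdBlocking QprimeIter Rbar)
open B8Eq119TwistedAxial (bgT InAx Restr129)
open B8Eq178Averages (Qnl util178)
open B8Eq1123Concrete (Cnl QprimeIter_line)
open B8Ineq125Concrete (C2p C2p_nonneg)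
open B8Eq1117Concrete (XSpace)
open B8SectEKLevelInLambda (eq1117_existsUnique_kLevel_w eq1117_solution_mem_of_invariant_w norm_Dprime_le_kLevel_w)
open B8SectEInLambdaWitness (witness_inv_of_axial)
open B12Ineq417Flat (shiftCfg shiftCfg_apply)
open B8TorusShiftAveraging (Rbar_bgT_shiftCfg)
open B9B8KnitLetterPeriodic (QprimeIter_bgT_shiftCfg)
open B8Prop5NeumannPeriodic (shiftCfg_eq_of_per)

-- `Site` alone could resolve to the torus sites of `Setup.lean`; re-export the `ℤ^d` sites of `B7Prop1Explicit`.
export B7Prop1Explicit (Site)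

variable {d : ℕ}

/-! ## §1 Translation covariance of `ũ′ʲ`, `Q′_j(u₁, ·)`, `C′_j(u₁, ·)` -/

section Shift

variable {𝔸 : Type*} [NormedRing 𝔸] [NormedAlgebra ℂ 𝔸] [CompleteSpace 𝔸]

/-- **ũ′ʲ of (1.78) for translated data**: translating `U₀`, `u′`, `u₁` on the fine lattice by `Lʲw` translates `ũ′ʲ` on the `j`-lattice by `w`.
[cite: Balaban1985RegularSpaces, (1.78) p.90; Balaban1985Averaging, (178)–(179) p.45] -/
theorem util178_shiftCfg (L : ℕ) (U₀ : Site d → Fin d → 𝔸ˣ) (u' u₁ : Site d → 𝔸ˣ) (j : ℕ) (w y : Site d) :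
    util178 L (shiftCfg (((L : ℤ) ^ j) • w) U₀) (shiftCfg (((L : ℤ) ^ j) • w) u') (shiftCfg (((L : ℤ) ^ j) • w) u₁) j y =
      util178 L U₀ u' u₁ j (y + w) := by
  unfold util178
  have h1 : (fun x => (((shiftCfg (((L : ℤ) ^ j) • w) u' * shiftCfg (((L : ℤ) ^ j) • w) u₁) x : 𝔸ˣ) : 𝔸)) =
      shiftCfg (((L : ℤ) ^ j) • w) (fun x => (((u' * u₁) x : 𝔸ˣ) : 𝔸)) := rfl
  have h2 : (fun x => ((shiftCfg (((L : ℤ) ^ j) • w) u₁ x : 𝔸ˣ) : 𝔸)) = shiftCfg (((L : ℤ) ^ j) • w) (fun x => ((u₁ x : 𝔸ˣ) : 𝔸)) := rfl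
  rw [h1, h2, Rbar_bgT_shiftCfg, Rbar_bgT_shiftCfg]

/-- **(208) `Q′_j(u₁, ·)` for translated data.** [cite: Balaban1985RegularSpaces, (1.79) p.90; Balaban1985Averaging, (208) p.50] -/
theorem Qnl_shiftCfg (L : ℕ) (U₀ : Site d → Fin d → 𝔸ˣ) (u' u₁ : Site d → 𝔸ˣ) (j : ℕ) (w y : Site d) :
    Qnl L (shiftCfg (((L : ℤ) ^ j) • w) U₀) (shiftCfg (((L : ℤ) ^ j) • w) u') (shiftCfg (((L : ℤ) ^ j) • w) u₁) j y = Qnl L U₀ u' u₁ j (y + w) := by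
  unfold Qnl
  rw [util178_shiftCfg]

/-- **(213)'s remainder `C′_j(u₁, λ) = Q′_j(u₁, λ) − Q′_jλ` for translated data.** [cite: Balaban1985RegularSpaces, (1.115) p.96; Balaban1985Averaging, (213) p.50] -/
theorem Cnl_shiftCfg (L : ℕ) (U₀ : Site d → Fin d → 𝔸ˣ) (u₁ : Site d → 𝔸ˣ) (j : ℕ) (w : Site d) (lam : Site d → 𝔸) (y : Site d) :
    Cnl L (shiftCfg (((L : ℤ) ^ j) • w) U₀) (shiftCfg (((L : ℤ) ^ j) • w) u₁) j (shiftCfg (((L : ℤ) ^ j) • w) lam) y = Cnl L U₀ u₁ j lam (y + w) := by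
  unfold Cnl
  have h : (fun x => expUnit (shiftCfg (((L : ℤ) ^ j) • w) lam x)) = shiftCfg (((L : ℤ) ^ j) • w) (fun x => expUnit (lam x)) := rfl
  rw [h, Qnl_shiftCfg, QprimeIter_bgT_shiftCfg]

/-- ★ **`C′_j(u₁, λ)` IS `P/Lʲ`-PERIODIC ON THE `j`-LATTICE** for `P`-periodic `U₀`, `u₁`, `λ` (`Lʲ ∣ P`). [cite: Balaban1985RegularSpaces, (1.115) p.96, §3 p.98] -/
theorem Cnl_per {L : ℕ} {j : ℕ} {P : ℤ} (hdiv : ((L : ℤ) ^ j ∣ P)) {U₀ : Site d → Fin d → 𝔸ˣ} {u₁ : Site d → 𝔸ˣ} {lam : Site d → 𝔸}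
    (hU₀ : ∀ (z : Site d) (i : Fin d), U₀ (z + P • e i) = U₀ z) (hu₁ : ∀ (z : Site d) (i : Fin d), u₁ (z + P • e i) = u₁ z)
    (hlam : ∀ (z : Site d) (i : Fin d), lam (z + P • e i) = lam z) :
    ∀ (y : Site d) (i : Fin d), Cnl L U₀ u₁ j lam (y + (P / (L : ℤ) ^ j) • e i) = Cnl L U₀ u₁ j lam y := by
  intro y i
  have ha : ((L : ℤ) ^ j) • ((P / (L : ℤ) ^ j) • e i) = P • e i := by rw [smul_smul, Int.mul_ediv_cancel' hdiv]
  rw [← Cnl_shiftCfg L U₀ u₁ j ((P / (L : ℤ) ^ j) • e i) lam y, ha, shiftCfg_eq_of_per hU₀ i, shiftCfg_eq_of_per hu₁ i,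
    shiftCfg_eq_of_per hlam i]

end Shift

/-! ## §2 The level-periodic `X : 𝔅_k → 𝔤` -/

section PerX

variable {𝔸 : Type*} [NormedRing 𝔸] [NormedAlgebra ℂ 𝔸] [CompleteSpace 𝔸]
variable {L : ℕ} {k : ℕ} {P : ℤ}

omit [NormedAlgebra ℂ 𝔸] [CompleteSpace 𝔸] in
/-- The level-periodic `X` (period `P/Lʲ` on the `j`-lattice) form a CLOSED subset of `XSpace` containing `0` (evaluations are continuous).
[cite: Balaban1985RegularSpaces, p.96 (the space of `X`), §3 p.98] -/
theorem isClosed_perX_and_zero_mem (L : ℕ) (P : ℤ) (k : ℕ) :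
    IsClosed {X : XSpace d k 𝔸 | (∀ (p : Fin (k + 1) × Site d) (i : Fin d), X (p.1, p.2 + (P / (L : ℤ) ^ (p.1 : ℕ)) • e i) = X p)} ∧
      (0 : XSpace d k 𝔸) ∈ {X : XSpace d k 𝔸 | (∀ (p : Fin (k + 1) × Site d) (i : Fin d), X (p.1, p.2 + (P / (L : ℤ) ^ (p.1 : ℕ)) • e i) = X p)} := by
  refine ⟨?_, fun p i => by simp⟩
  have hset : {X : XSpace d k 𝔸 | (∀ (p : Fin (k + 1) × Site d) (i : Fin d), X (p.1, p.2 + (P / (L : ℤ) ^ (p.1 : ℕ)) • e i) = X p)} =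
      ⋂ (p : Fin (k + 1) × Site d), ⋂ (i : Fin d), {X : XSpace d k 𝔸 | X (p.1, p.2 + (P / (L : ℤ) ^ (p.1 : ℕ)) • e i) = X p} := by
    ext X; simp
  rw [hset]
  refine isClosed_iInter fun p => isClosed_iInter fun i => ?_
  exact isClosed_eq (ContinuousEvalConst.continuous_eval_const _) (ContinuousEvalConst.continuous_eval_const _)

/-- **The masked (1.118) maps level-periodic data to level-periodic `X`**: if `Y = C′_j(u₁, μ)` on `Λ_j` and `0` off `Λ_j` with `μ` periodic,
`U₀`, `u₁` periodic, `Lʲ ∣ P` and `Λ_j` shift-invariant, then `Y` is level-periodic. [cite: Balaban1985RegularSpaces, (1.117)–(1.118) p.96, §3 p.98] -/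
theorem perX_of_image {Λ : ℕ → Set (Site d)} {U₀ : Site d → Fin d → 𝔸ˣ} {u₁ : Site d → 𝔸ˣ} {μ : Site d → 𝔸}
    (hdiv : ∀ j, j ≤ k → ((L : ℤ) ^ j ∣ P))
    (hΛ : ∀ j, j ≤ k → ∀ (y : Site d) (i : Fin d), y + (P / (L : ℤ) ^ j) • e i ∈ Λ j ↔ y ∈ Λ j)
    (hU₀per : ∀ (z : Site d) (i : Fin d), U₀ (z + P • e i) = U₀ z) (hu₁per : ∀ (z : Site d) (i : Fin d), u₁ (z + P • e i) = u₁ z)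
    (hμ : ∀ (z : Site d) (i : Fin d), μ (z + P • e i) = μ z) {Y : XSpace d k 𝔸}
    (hY : ∀ p : Fin (k + 1) × Site d, (p.2 ∈ Λ p.1 → Y p = Cnl L U₀ u₁ p.1 μ p.2) ∧ (p.2 ∉ Λ p.1 → Y p = 0)) :
    (∀ (p : Fin (k + 1) × Site d) (i : Fin d), Y (p.1, p.2 + (P / (L : ℤ) ^ (p.1 : ℕ)) • e i) = Y p) := by
  intro p i
  have hk : (p.1 : ℕ) ≤ k := Nat.le_of_lt_succ p.1.isLt
  by_cases hp : p.2 ∈ Λ p.1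
  · have hp' : p.2 + (P / (L : ℤ) ^ (p.1 : ℕ)) • e i ∈ Λ p.1 := (hΛ _ hk p.2 i).2 hp
    rw [(hY (p.1, p.2 + (P / (L : ℤ) ^ (p.1 : ℕ)) • e i)).1 hp', (hY p).1 hp]
    exact Cnl_per (hdiv _ hk) hU₀per hu₁per hμ p.2 i
  · have hp' : p.2 + (P / (L : ℤ) ^ (p.1 : ℕ)) • e i ∉ Λ p.1 := fun h => hp ((hΛ _ hk p.2 i).1 h)
    rw [(hY (p.1, p.2 + (P / (L : ℤ) ^ (p.1 : ℕ)) • e i)).2 hp', (hY p).2 hp]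

/-- **(1.114) from `Q′H′ = I` READ AT THE SOLUTION** — `B8Eq1117KLevel.eq1114_of_fixedPoint_kLevel` with its hypothesis `hQH` assumed for
`Y = X` only. [cite: Balaban1985RegularSpaces, (1.113)–(1.116) pp.95–96, (1.91) p.91; Balaban1985Averaging, (213) p.50] -/
theorem eq1114_of_fixedPoint_kLevel_at {U₀ : Site d → Fin d → 𝔸ˣ} {u₁ : Site d → 𝔸ˣ} (Λ : ℕ → Set (Site d))
    (H' : XSpace d k 𝔸 →ₗ[ℂ] (Site d → 𝔸)) {lam : Site d → 𝔸} {X : XSpace d k 𝔸}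
    (hQHX : ∀ (j : ℕ) (hj : j ≤ k) (y : Site d), y ∈ Λ j →
      QprimeIter (zdBlocking d L) (bgT L U₀) j (H' X) y = X (⟨j, Nat.lt_succ_of_le hj⟩, y))
    (hfix : ∀ (j : ℕ) (hj : j ≤ k) (y : Site d), y ∈ Λ j →
      Cnl L U₀ u₁ j (lam - H' X) y = X (⟨j, Nat.lt_succ_of_le hj⟩, y)) :
    ∀ (j : ℕ), j ≤ k → ∀ y ∈ Λ j,
      Qnl L U₀ (fun x => expUnit ((lam - H' X) x)) u₁ j y = QprimeIter (zdBlocking d L) (bgT L U₀) j lam y := by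
  intro j hj y hy
  have h213 : Qnl L U₀ (fun x => expUnit ((lam - H' X) x)) u₁ j y =
      QprimeIter (zdBlocking d L) (bgT L U₀) j (lam - H' X) y + Cnl L U₀ u₁ j (lam - H' X) y := by
    rw [Cnl]; abel
  have hlin : QprimeIter (zdBlocking d L) (bgT L U₀) j (lam - H' X) y =
      QprimeIter (zdBlocking d L) (bgT L U₀) j lam y - QprimeIter (zdBlocking d L) (bgT L U₀) j (H' X) y := by
    have h1 : lam - H' X = lam + (-1 : ℂ) • H' X := by rw [neg_one_smul, sub_eq_add_neg]
    rw [h1, QprimeIter_line, neg_one_smul, sub_eq_add_neg]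
  rw [h213, hlin, hQHX j hj y hy, hfix j hj y hy]
  abel

end PerX

/-! ## §3 `D′(λ)` on the torus: periodic, with (1.114) from `Q′H′ = I` at periodic families -/

section Dprime

variable {𝔸 : Type*} [NormedRing 𝔸] [NormOneClass 𝔸] [NormedAlgebra ℂ 𝔸] [CompleteSpace 𝔸]
variable {L : ℕ} {G : Subgroup 𝔸ˣ} {U₀ : Site d → Fin d → 𝔸ˣ} {k : ℕ} {Λ : ℕ → Set (Site d)} {H' : XSpace d k 𝔸 →ₗ[ℂ] (Site d → 𝔸)}
  {lam : Site d → 𝔸} {u₁ : Site d → 𝔸ˣ} {α₀ α₃ α₄ B₀' : ℝ}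

/-- ★ **`D′(λ)` + (1.114) AT `k` LEVELS, WITNESS FORM, ON THE TORUS** — `B8SectEKLevelInLambda.exists_Dprime_kLevel_w` VERBATIM with `hQH` at
level-periodic `Y` only and the torus data; ADDED: `D′(λ)` is level-periodic. [cite: Balaban1985RegularSpaces, (1.113)–(1.114) p.95, (1.117) p.96, p.97, §3 p.98] -/
theorem exists_Dprime_kLevel_w_per (hL : 2 ≤ L) (hL1 : 1 ≤ L) (hG : AvgClosed d L G) (hU₀ : ∀ x κ, U₀ x κ ∈ G)
    (hα : 0 < α₀) (hα3 : C0 d * α₀ ≤ 1 / 3) (hα4 : 4 * α₀ ≤ c2' d L) (hα₃ : 0 ≤ α₃) (hα₄ : 0 < α₄) (hB : 0 < B₀')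
    (h33 : ∀ j, j ≤ k → ∀ y ∈ Λ j, pdevOn (tlo L y j) (thi L y j) U₀ < α₀ * (((L : ℝ) ^ j)⁻¹) ^ 2)
    (hwit : ∀ j, j ≤ k → ∀ y ∈ Λ j, ∃ ut : Site d → 𝔸ˣ,
      InLambda L (clampCfg (tlo L y j) (thi L y j) U₀) ut j α₃ (((L : ℝ) ^ j)⁻¹) ∧
      ∀ x : Site d, tlo L y j ≤ x → x ≤ thi L y j → u₁ x = ut x)
    (h119b : ∀ j, j ≤ k → ∀ y ∈ Λ j, ∀ x : Site d, InBox (tlo L y j) (thi L y j) x → ‖lam x‖ < α₄ / 2)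
    (h119a : ∀ j, j ≤ k → ∀ y ∈ Λ j, ∀ (x : Site d) (κ : Fin d), InBox (tlo L y j) (thi L y j) x →
      InBox (tlo L y j) (thi L y j) (x + e κ) → ‖cj (U₀ x κ) (lam (x + e κ)) - lam x‖ < α₄ / 2 * ((L : ℝ) ^ j)⁻¹)
    (hH0 : ∀ (X : XSpace d k 𝔸) (x : Site d), ‖H' X x‖ ≤ B₀' * ‖X‖)
    (hH1 : ∀ j, j ≤ k → ∀ y ∈ Λ j, ∀ (X : XSpace d k 𝔸) (x : Site d) (κ : Fin d), InBox (tlo L y j) (thi L y j) x →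
      InBox (tlo L y j) (thi L y j) (x + e κ) → ‖cj (U₀ x κ) (H' X (x + e κ)) - H' X x‖ ≤ B₀' * ‖X‖ * ((L : ℝ) ^ j)⁻¹)
    -- the torus: period `P` divisible by every `Lʲ`, shift-invariant `Λ_j`, periodic `U₀`, `u₁`, `λ`, periodicity-preserving `H′`
    (P : ℤ) (hdiv : ∀ j, j ≤ k → ((L : ℤ) ^ j ∣ P))
    (hΛ : ∀ j, j ≤ k → ∀ (y : Site d) (i : Fin d), y + (P / (L : ℤ) ^ j) • e i ∈ Λ j ↔ y ∈ Λ j)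
    (hU₀per : ∀ (z : Site d) (i : Fin d), U₀ (z + P • e i) = U₀ z) (hu₁per : ∀ (z : Site d) (i : Fin d), u₁ (z + P • e i) = u₁ z)
    (hlamper : (∀ (z : Site d) (i : Fin d), lam (z + P • e i) = lam z))
    (hHper : ∀ X : XSpace d k 𝔸, (∀ (p : Fin (k + 1) × Site d) (i : Fin d), X (p.1, p.2 + (P / (L : ℤ) ^ (p.1 : ℕ)) • e i) = X p) →
      ∀ (z : Site d) (i : Fin d), H' X (z + P • e i) = H' X z)
    (hQH : ∀ (Y : XSpace d k 𝔸), (∀ (p : Fin (k + 1) × Site d) (i : Fin d), Y (p.1, p.2 + (P / (L : ℤ) ^ (p.1 : ℕ)) • e i) = Y p) →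
      ∀ (j : ℕ) (hj : j ≤ k) (y : Site d), y ∈ Λ j →
      QprimeIter (zdBlocking d L) (bgT L U₀) j (H' Y) y = Y (⟨j, Nat.lt_succ_of_le hj⟩, y))
    (hα₃' : α₃ ≤ 1 / 200) (hs₁ : 200 * C6 d * (2 * α₄) ≤ 1) (hs₂ : 12000 * ((d : ℝ) + 1) * L * (2 * α₄) ≤ 1)
    (hs₃ : C4G d L * (α₀ + α₃ + 4 * (2 * α₄)) ≤ 1)
    (hs₄ : 1024 * ((d : ℝ) + 1) * ((d : ℝ) + 4) * L ^ 2 * α₀ ≤ 1) (hs₅ : 32 * ((d : ℝ) + 1) ^ 2 * C6 d * L ^ 2 * α₀ ≤ 1)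
    (hs₆ : 16 * d * C5' d * C6 d * (L : ℝ) ^ 2 * α₀ ≤ 1) (hs₇ : 8 * d * C6 d * L * α₀ ≤ 1)
    (hsm : α₃ + α₄ ≤ 1 / (4 * B₀' * (2 * C2p d))) :
    ∃ X : XSpace d k 𝔸, (∀ (p : Fin (k + 1) × Site d) (i : Fin d), X (p.1, p.2 + (P / (L : ℤ) ^ (p.1 : ℕ)) • e i) = X p) ∧
      ‖X‖ ≤ α₄ / (2 * B₀') ∧ ‖X‖ ≤ C2p d * (α₃ + α₄) * α₄ ∧
      (∀ (j : ℕ) (hj : j ≤ k) (y : Site d), y ∉ Λ j → X (⟨j, Nat.lt_succ_of_le hj⟩, y) = 0) ∧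
      (∀ (j : ℕ) (hj : j ≤ k) (y : Site d), y ∈ Λ j →
        Cnl L U₀ u₁ j (lam - H' X) y = X (⟨j, Nat.lt_succ_of_le hj⟩, y)) ∧
      ∀ (j : ℕ), j ≤ k → ∀ y ∈ Λ j,
        Qnl L U₀ (fun x => expUnit ((lam - H' X) x)) u₁ j y = QprimeIter (zdBlocking d L) (bgT L U₀) j lam y := by
  obtain ⟨X, ⟨hXρ, hXfix⟩, -⟩ := eq1117_existsUnique_kLevel_w hL hL1 hG hU₀ hα hα3 hα4 hα₃ hα₄ hB h33 hwit h119b h119a hH0 hH1 hα₃'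
    hs₁ hs₂ hs₃ hs₄ hs₅ hs₆ hs₇ hsm
  have hfix : ∀ (j : ℕ) (hj : j ≤ k) (y : Site d), y ∈ Λ j → Cnl L U₀ u₁ j (lam - H' X) y = X (⟨j, Nat.lt_succ_of_le hj⟩, y) :=
    fun j hj y hy => ((hXfix j hj y).1 hy).symm
  have hzero : ∀ (j : ℕ) (hj : j ≤ k) (y : Site d), y ∉ Λ j → X (⟨j, Nat.lt_succ_of_le hj⟩, y) = 0 :=
    fun j hj y hy => (hXfix j hj y).2 hy
  -- the smallness at `α₄` from the one at `2α₄`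
  have hC6 : (0 : ℝ) ≤ C6 d := by unfold C6; linarith [one_le_C5 (d := d)]
  have hC4G : 0 ≤ C4G d L := by
    have h7 : (0 : ℝ) ≤ B7Prop10General.C7 d := by
      unfold B7Prop10General.C7 C6; linarith [one_le_C5 (d := d), C5'_nonneg (d := d)]
    have h4' := C4'_nonneg (d := d)
    unfold C4G; positivity
  have hs₁' : 200 * C6 d * α₄ ≤ 1 :=
    (mul_le_mul_of_nonneg_left (by linarith only [hα₄]) (by positivity)).trans hs₁
  have hs₂' : 12000 * ((d : ℝ) + 1) * L * α₄ ≤ 1 :=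
    (mul_le_mul_of_nonneg_left (by linarith only [hα₄]) (by positivity)).trans hs₂
  have hs₃' : C4G d L * (α₀ + α₃ + 4 * α₄) ≤ 1 :=
    (mul_le_mul_of_nonneg_left (by linarith only [hα₄]) hC4G).trans hs₃
  have hbd := norm_Dprime_le_kLevel_w hL hL1 hG hU₀ hα hα3 hα4 hα₃ hα₄ hB h33 hwit h119b h119a hH0 hH1 hα₃' hs₁' hs₂' hs₃' hs₄ hs₅
    hs₆ hs₇ hXρ hzero hfix
  -- on the torus: the solution is periodic (the periodic `X` form a closed invariant set containing `0`)
  obtain ⟨hcl, h0⟩ := isClosed_perX_and_zero_mem (𝔸 := 𝔸) (d := d) L P k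
  have hper : (∀ (p : Fin (k + 1) × Site d) (i : Fin d), X (p.1, p.2 + (P / (L : ℤ) ^ (p.1 : ℕ)) • e i) = X p) :=
    eq1117_solution_mem_of_invariant_w hL hL1 hG hU₀ hα hα3 hα4 hα₃ hα₄ hB h33 hwit h119b h119a hH0 hH1 hα₃' hs₁ hs₂ hs₃ hs₄ hs₅ hs₆ hs₇
      hsm _ hcl h0 (fun X' hX' _ Y hY => perX_of_image (Λ := Λ) hdiv hΛ hU₀per hu₁per
        (fun z i => by simp only [Pi.sub_apply, hlamper z i, hHper X' hX' z i]) hY) hXρ hzero hfix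
  exact ⟨X, hper, hXρ, hbd, hzero, hfix, eq1114_of_fixedPoint_kLevel_at Λ H' (hQH X hper) hfix⟩


end Dprime

section Inverse

variable {𝔸 : Type*} [CStarAlgebra 𝔸] [Nontrivial 𝔸]
variable {L : ℕ} {U₀ : Site d → Fin d → 𝔸ˣ} {k : ℕ} {Λ : ℕ → Set (Site d)} {H' : XSpace d k 𝔸 →ₗ[ℂ] (Site d → 𝔸)}
  {lam : Site d → 𝔸} {u₁ : Site d → 𝔸ˣ} {α₀ αP α₄ B₀' c : ℝ} {B : Site d → Fin d → 𝔸}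

/-- ★ **`D′(λ)` FOR THE INVERSE PAIR AT THEOREM 4's INDUCTIVE `u₁`, ON THE TORUS** — `B8SectEKLevelInLambda.exists_Dprime_kLevel_inv_of_axial`
VERBATIM with `hQH` at level-periodic `Y` only and the torus data; ADDED: `D′(λ)` is level-periodic.
[cite: Balaban1985RegularSpaces, (1.113)–(1.121) pp.95–97, (1.112) p.95, (1.29) p.81, §3 p.98; Balaban1985Averaging, Prop. 10 p.50] -/
theorem exists_Dprime_kLevel_inv_of_axial_per (hd : 1 ≤ d) (hL : 2 ≤ L) (hL1 : 1 ≤ L) (hU₀ : ∀ x κ, U₀ x κ ∈ unitaryUnits 𝔸)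
    (hα : 0 < α₀) (hα3 : C0 d * α₀ ≤ 1 / 3) (hα4 : 4 * α₀ ≤ c2' d L) (hc : 0 ≤ c) (hα₄ : 0 < α₄) (hB : 0 < B₀')
    (hαP : 0 < αP) (hαP3 : C0 d * αP ≤ 1 / 3) (hαP2 : 2 * αP ≤ c2' d L)
    (hBu : ∀ (x : Site d) (κ : Fin d), expCfg B x κ ∈ unitaryUnits 𝔸)
    (h33 : ∀ j, j ≤ k → ∀ y ∈ Λ j, pdevOn (tlo L y j) (thi L y j) U₀ < α₀ * (((L : ℝ) ^ j)⁻¹) ^ 2)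
    (h69 : ∀ j, j ≤ k → ∀ y ∈ Λ j, ∀ (x : Site d) (κ : Fin d), InBox (tlo L y j) (thi L y j) x →
      InBox (tlo L y j) (thi L y j) (x + e κ) → ‖B x κ‖ ≤ c * ((L : ℝ) ^ j)⁻¹)
    (hP : ∀ j, j ≤ k → ∀ y ∈ Λ j, pdevOn (tlo L y j) (thi L y j) (expCfg B * U₀) < αP * (((L : ℝ) ^ j)⁻¹) ^ 2)
    (hAx : InAx L k Λ U₀ (mgauge U₀ u₁ (expCfg B) * U₀)) (h129 : Restr129 L k Λ U₀ u₁)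
    (h119b : ∀ j, j ≤ k → ∀ y ∈ Λ j, ∀ x : Site d, InBox (tlo L y j) (thi L y j) x → ‖lam x‖ < α₄ / 2)
    (h119a : ∀ j, j ≤ k → ∀ y ∈ Λ j, ∀ (x : Site d) (κ : Fin d), InBox (tlo L y j) (thi L y j) x →
      InBox (tlo L y j) (thi L y j) (x + e κ) → ‖cj (U₀ x κ) (lam (x + e κ)) - lam x‖ < α₄ / 2 * ((L : ℝ) ^ j)⁻¹)
    (hH0 : ∀ (X : XSpace d k 𝔸) (x : Site d), ‖H' X x‖ ≤ B₀' * ‖X‖)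
    (hH1 : ∀ j, j ≤ k → ∀ y ∈ Λ j, ∀ (X : XSpace d k 𝔸) (x : Site d) (κ : Fin d), InBox (tlo L y j) (thi L y j) x →
      InBox (tlo L y j) (thi L y j) (x + e κ) → ‖cj (U₀ x κ) (H' X (x + e κ)) - H' X x‖ ≤ B₀' * ‖X‖ * ((L : ℝ) ^ j)⁻¹)
    -- the torus: period `P` divisible by every `Lʲ`, shift-invariant `Λ_j`, periodic `U₀`, `u₁`, `λ`, periodicity-preserving `H′`
    (P : ℤ) (hdiv : ∀ j, j ≤ k → ((L : ℤ) ^ j ∣ P))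
    (hΛ : ∀ j, j ≤ k → ∀ (y : Site d) (i : Fin d), y + (P / (L : ℤ) ^ j) • e i ∈ Λ j ↔ y ∈ Λ j)
    (hU₀per : ∀ (z : Site d) (i : Fin d), U₀ (z + P • e i) = U₀ z) (hu₁per : ∀ (z : Site d) (i : Fin d), u₁ (z + P • e i) = u₁ z)
    (hlamper : (∀ (z : Site d) (i : Fin d), lam (z + P • e i) = lam z))
    (hHper : ∀ X : XSpace d k 𝔸, (∀ (p : Fin (k + 1) × Site d) (i : Fin d), X (p.1, p.2 + (P / (L : ℤ) ^ (p.1 : ℕ)) • e i) = X p) →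
      ∀ (z : Site d) (i : Fin d), H' X (z + P • e i) = H' X z)
    (hQH : ∀ (Y : XSpace d k 𝔸), (∀ (p : Fin (k + 1) × Site d) (i : Fin d), Y (p.1, p.2 + (P / (L : ℤ) ^ (p.1 : ℕ)) • e i) = Y p) →
      ∀ (j : ℕ) (hj : j ≤ k) (y : Site d), y ∈ Λ j →
      QprimeIter (zdBlocking d L) (bgT L U₀) j (H' Y) y = Y (⟨j, Nat.lt_succ_of_le hj⟩, y))
    (hsmall : Real.exp (4 * (800 * ((d : ℝ) + 1) ^ 2 * ((d : ℝ) + 4)) * α₀) * (1 + 8 * (131072 * ((d : ℝ) + 1) ^ 2) * c) ≤ 2)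
    (hc₃ : 2 * c ≤ c3 d L) (hsc : 2048 * (d : ℝ) * c ≤ 1) (hα₃' : 40 * d * c ≤ 1 / 200)
    (hs₁ : 200 * C6 d * (2 * α₄) ≤ 1) (hs₂ : 12000 * ((d : ℝ) + 1) * L * (2 * α₄) ≤ 1)
    (hs₃ : C4G d L * (α₀ + 40 * d * c + 4 * (2 * α₄)) ≤ 1)
    (hs₄ : 1024 * ((d : ℝ) + 1) * ((d : ℝ) + 4) * L ^ 2 * α₀ ≤ 1) (hs₅ : 32 * ((d : ℝ) + 1) ^ 2 * C6 d * L ^ 2 * α₀ ≤ 1)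
    (hs₆ : 16 * d * C5' d * C6 d * (L : ℝ) ^ 2 * α₀ ≤ 1) (hs₇ : 8 * d * C6 d * L * α₀ ≤ 1)
    (hsm : 40 * d * c + α₄ ≤ 1 / (4 * B₀' * (2 * C2p d))) :
    ∃ X : XSpace d k 𝔸, (∀ (p : Fin (k + 1) × Site d) (i : Fin d), X (p.1, p.2 + (P / (L : ℤ) ^ (p.1 : ℕ)) • e i) = X p) ∧
      ‖X‖ ≤ α₄ / (2 * B₀') ∧ ‖X‖ ≤ C2p d * (40 * d * c + α₄) * α₄ ∧
      (∀ (j : ℕ) (hj : j ≤ k) (y : Site d), y ∉ Λ j → X (⟨j, Nat.lt_succ_of_le hj⟩, y) = 0) ∧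
      (∀ (j : ℕ) (hj : j ≤ k) (y : Site d), y ∈ Λ j →
        Cnl L U₀ u₁⁻¹ j (lam - H' X) y = X (⟨j, Nat.lt_succ_of_le hj⟩, y)) ∧
      ∀ (j : ℕ), j ≤ k → ∀ y ∈ Λ j,
        Qnl L U₀ (fun x => expUnit ((lam - H' X) x)) u₁⁻¹ j y = QprimeIter (zdBlocking d L) (bgT L U₀) j lam y :=
  exists_Dprime_kLevel_w_per hL hL1 (avgClosed_unitaryUnits d L) hU₀ hα hα3 hα4 (by positivity) hα₄ hB h33
    (witness_inv_of_axial hd hL hU₀ Λ hα hα3 hα4 hc hsmall hc₃ hsc hαP hαP3 hαP2 hL1 hBu h33 h69 hP hAx h129)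
    h119b h119a hH0 hH1 P hdiv hΛ hU₀per (fun z i => by rw [Pi.inv_apply, Pi.inv_apply, hu₁per z i]) hlamper hHper hQH hα₃' hs₁ hs₂ hs₃
    hs₄ hs₅ hs₆ hs₇ hsm


end Inverse

#print axioms Cnl_per
#print axioms exists_Dprime_kLevel_w_per
#print axioms exists_Dprime_kLevel_inv_of_axial_per

end Literature.MathematicalPhysics.QuantumFieldTheory.Balaban1983to89.B8SectEKLevelPer

end
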